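import Summits.Ventures.PercRepro.RankLevelSetCorankFour
import Summits.Ventures.PercRepro.RankLevelSetTheoremCFull

/-!
# PercRepro — C-025 at `q = 3` for EVERY finite matroid of corank `≤ 4` and rank `≥ 97` (night-1, gen 1)

The explicit-threshold companion of `exists_P_c025_bounded` at `(q, D) = (3, 4)`: the bounded-corank reduction
`rls_succ_bounded` (loops, parallel pairs, truncation, corank `< 3` empty, corank `3` = Theorem M, Theorem N at level
`2`) fed with the explicit simple-core theorem `c025_corank_four_simple` (corank `4`, `|E| ≥ 100`).

* **`c025_three_corank_four_explicit`** — for every finite matroid `M` and every `p ≥ 97` with `|E| ≤ p + 4`,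
  `Φ(p,3)·#U(p,3) ≤ #Y(p,3)` (the `C025` body `RLS M p 3`).
Axioms: standard.
-/

namespace PercRepro

namespace ThmN

variable {α : Type}

/-- **C-025 at `q = 3`, corank `≤ 4`, EXPLICIT threshold**: every finite matroid `M` and every `p ≥ 97` with
`|E| ≤ p + 4` satisfy `Φ(p,3)·#U(p,3) ≤ #Y(p,3)` — no simplicity, no rank condition, coloops allowed. -/
theorem c025_three_corank_four_explicit (M : Matroid α) [M.Finite] (p : ℕ) (hp : 97 ≤ p)
    (hD : M.E.ncard ≤ p + 4) : RLS M p 3 := by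
  have h := rls_succ_bounded (α := α) 2 4 96
    (fun M' _ p' _ _ hp' => c025_two_all M' p' (by omega))
    (fun M' _ p' d hP' hd hdD hEd hR _ hc => by
      have hd4 : d = 4 := by omega
      subst hd4
      have hn : M'.E.ncard = p' + 4 := by
        have h := hEd
        rw [← M'.ground_finite.cast_ncard_eq, hR] at h
        exact_mod_cast h
      rw [RLS_iff]
      exact c025_corank_four_simple M' p' (by omega) hEd hR hc)
    M p (by omega) hD (by omega)
  exact h

end ThmN

end PercRepro
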